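import Summits.Ventures.PercRepro2.CaseOneMoves
import Summits.Ventures.PercRepro2.CaseOneGlued

/-!
# Moves carrying the weight vector: the glued classes join the closure machinery
(blind cell PercRepro2, p1 g23; S5 §2.1 (K9) — the relation `Moves` of CaseOneMoves with the weight vector
transported along every step)

`ClosedAt` (CaseOneThickeningRel) is the four forms for EVERY weight vector, so the closed anchors of the
rung are weight-free classes. The glued classes of CaseOneGlued are WEIGHT-SPECIFIC: `a₃` with every edge to
`a₁` or to `w` and some edge `{a₂, w}` of weight `1` (and the `₁` twins) have all four forms at `a₃` for that
weight vector. `MoveStepW` / `MovesW` are the moves of CaseOneMoves with the weight vector carried along —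
leaf attachment (`restrictW`), parallel duplication (`mergeW`), series subdivision (`seriesW`), loop
addition (`restrictW`), and the pendant step (`restrictW`, the statement vertex moving to the leaf) —
and **`fourForms_of_movesW`** says that the four forms for a weight vector travel along every sequence of
weighted moves (`fourForms_of_restrict / merge / series / loop` and K8 with its Q-side, exactly as
`closedAt_of_moves`). With the glued anchors `fourForms_of_rootsOnly_glued₁/₂` this gives
**`fourForms_of_movesW_glued₁/₂`**: the four forms for every weight vector reachable by weighted moves from a
glued instance — pendant trees, series–parallel thickenings and loops grown on a glued instance, the
weight-`1` edge kept. Own code; standard axioms. -/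

namespace Summit.Ventures.PercRepro2

namespace CaseOne

universe u

section MovesW
variable {V : Type*} {R : Type*} [CommRing R]

/-- **One weighted move**: a thickening step with the weight vector transported (`restrictW`, `mergeW`,
`seriesW`, `restrictW`) and the statement vertex fixed, or the pendant step (the statement vertex moving
from `x` to a new leaf `a₃ ∉ {o, a₁, a₂, b}` at `x`, the weight vector restricted). -/
inductive MoveStepW (o a₁ a₂ b : V) :
    (E' : Type u) → [Fintype E'] → [DecidableEq E'] → (E' → Sym2 V) → (E' → R) → V →
      (E : Type u) → [Fintype E] → [DecidableEq E] → (E → Sym2 V) → (E → R) → V → Prop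
  /-- a leaf `a₃ ∉ {o, a₁, a₂, v, b}` hanging at `u` through `e₀`; the weight vector restricted -/
  | leaf (E : Type u) [Fintype E] [DecidableEq E] (ends : E → Sym2 V) (p : E → R) (v u a₃ : V) (e₀ : E)
      (hl : IsLeafAt ends u a₃ e₀) (ho : o ≠ a₃) (h1 : a₁ ≠ a₃) (h2 : a₂ ≠ a₃) (hv : v ≠ a₃)
      (hb : b ≠ a₃) :
      MoveStepW o a₁ a₂ b {e : E // e ≠ e₀} (restrictEnds ends e₀) (restrictW p e₀) v E ends p v
  /-- a parallel copy `e₁` of the edge `e₀`; the merged weight `p e₀ + p e₁ − p e₀ p e₁` at `e₀` -/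
  | par (E : Type u) [Fintype E] [DecidableEq E] (ends : E → Sym2 V) (p : E → R) (v : V) (e₀ e₁ : E)
      (hpar : ends e₀ = ends e₁) (hne : e₀ ≠ e₁) :
      MoveStepW o a₁ a₂ b {e : E // e ≠ e₁} (restrictEnds ends e₁) (mergeW p e₀ e₁) v E ends p v
  /-- an edge `{x, z}` subdivided by a new vertex `w ∉ {o, a₁, a₂, v, b}`; the product weight at `e₀` -/
  | series (E : Type u) [Fintype E] [DecidableEq E] (ends : E → Sym2 V) (p : E → R) (v x w z : V)
      (e₀ e₁ : E) (hs : IsSeriesAt ends x w z e₀ e₁) (ho : o ≠ w) (h1 : a₁ ≠ w) (h2 : a₂ ≠ w)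
      (hv : v ≠ w) (hb : b ≠ w) :
      MoveStepW o a₁ a₂ b {e : E // e ≠ e₁} (seriesEnds ends e₀ e₁ x z) (seriesW p e₀ e₁) v E ends p v
  /-- a loop `e₀` at `x`; the weight vector restricted -/
  | loop (E : Type u) [Fintype E] [DecidableEq E] (ends : E → Sym2 V) (p : E → R) (v x : V) (e₀ : E)
      (hl : ends e₀ = s(x, x)) :
      MoveStepW o a₁ a₂ b {e : E // e ≠ e₀} (restrictEnds ends e₀) (restrictW p e₀) v E ends p v
  /-- the pendant step: the statement vertex moves from `x` to the leaf `a₃` at `x` -/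
  | leafMove (E : Type u) [Fintype E] [DecidableEq E] (ends : E → Sym2 V) (p : E → R) (x a₃ : V)
      (e₀ : E) (hl : IsLeafAt ends x a₃ e₀) (ho : o ≠ a₃) (h1 : a₁ ≠ a₃) (h2 : a₂ ≠ a₃) (hb : b ≠ a₃) :
      MoveStepW o a₁ a₂ b {e : E // e ≠ e₀} (restrictEnds ends e₀) (restrictW p e₀) x E ends p a₃

/-- **Weighted moves**: finitely many `MoveStepW`s (an inductive family: the edge type, the weight vector
and the statement vertex change along the way). -/
inductive MovesW (o a₁ a₂ b : V) :
    (E' : Type u) → [Fintype E'] → [DecidableEq E'] → (E' → Sym2 V) → (E' → R) → V →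
      (E : Type u) → [Fintype E] → [DecidableEq E] → (E → Sym2 V) → (E → R) → V → Prop
  /-- no move -/
  | refl (E : Type u) [Fintype E] [DecidableEq E] (ends : E → Sym2 V) (p : E → R) (v : V) :
      MovesW o a₁ a₂ b E ends p v E ends p v
  /-- one more move -/
  | tail {E' : Type u} [Fintype E'] [DecidableEq E'] {ends' : E' → Sym2 V} {p' : E' → R} {v' : V}
      {Em : Type u} [Fintype Em] [DecidableEq Em] {endsm : Em → Sym2 V} {pm : Em → R} {vm : V}
      {E : Type u} [Fintype E] [DecidableEq E] {ends : E → Sym2 V} {p : E → R} {v : V}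
      (h : MovesW o a₁ a₂ b E' ends' p' v' Em endsm pm vm)
      (hstep : MoveStepW o a₁ a₂ b Em endsm pm vm E ends p v) : MovesW o a₁ a₂ b E' ends' p' v' E ends p v

variable [LinearOrder R] [IsStrictOrderedRing R] {o a₁ a₂ b : V}

/-- The transported weight vector of an admissible weight vector is admissible. -/
theorem MoveStepW.isProbVec {E' : Type u} [Fintype E'] [DecidableEq E'] {ends' : E' → Sym2 V}
    {p' : E' → R} {v' : V} {E : Type u} [Fintype E] [DecidableEq E] {ends : E → Sym2 V} {p : E → R}
    {v : V} (h : MoveStepW o a₁ a₂ b E' ends' p' v' E ends p v) (hp : IsProbVec p) : IsProbVec p' := by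
  cases h with
  | leaf _ _ _ _ _ _ e₀ _ _ _ _ _ _ => exact IsProbVec.restrictW hp e₀
  | par _ _ _ _ e₀ e₁ _ _ => exact IsProbVec.mergeW hp e₀ e₁
  | series _ _ _ _ _ _ _ e₀ e₁ _ _ _ _ _ _ => exact IsProbVec.seriesW hp e₀ e₁
  | loop _ _ _ _ _ e₀ _ => exact IsProbVec.restrictW hp e₀
  | leafMove _ _ _ _ _ e₀ _ _ _ _ _ => exact IsProbVec.restrictW hp e₀

/-- Along any sequence of weighted moves the weight vectors stay admissible. -/
theorem MovesW.isProbVec {E' : Type u} [Fintype E'] [DecidableEq E'] {ends' : E' → Sym2 V}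
    {p' : E' → R} {v' : V} {E : Type u} [Fintype E] [DecidableEq E] {ends : E → Sym2 V} {p : E → R}
    {v : V} (h : MovesW o a₁ a₂ b E' ends' p' v' E ends p v) (hp : IsProbVec p) : IsProbVec p' := by
  induction h with
  | refl => exact hp
  | tail _ hstep ih => exact ih (hstep.isProbVec hp)

/-- **One weighted move carries the four forms** (the four transfers of CaseOneThickening /
CaseOneLoopDelete, and K8 with its Q-side for the pendant step). -/
theorem fourForms_of_moveStepW {E' : Type u} [Fintype E'] [DecidableEq E'] {ends' : E' → Sym2 V}
    {p' : E' → R} {v' : V} {E : Type u} [Fintype E] [DecidableEq E] {ends : E → Sym2 V} {p : E → R}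
    {v : V} (h : MoveStepW o a₁ a₂ b E' ends' p' v' E ends p v) (hp : IsProbVec p)
    (hc : FourForms p' ends' o a₁ a₂ v' b) : FourForms p ends o a₁ a₂ v b := by
  cases h with
  | leaf _ _ _ _ _ _ _ hl ho h1 h2 hv hb => exact fourForms_of_restrict p hl ho h1 h2 hv hb hc
  | par _ _ _ _ _ _ hpar hne => exact fourForms_of_merge p hpar hne hc
  | series _ _ _ _ _ _ _ _ _ hs ho h1 h2 hv hb => exact fourForms_of_series p hs ho h1 h2 hv hb hc
  | loop _ _ _ _ _ _ hl => exact fourForms_of_loop p hl hc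
  | leafMove _ _ _ _ _ _ hl ho h1 h2 hb =>
    have hx := fourForms_of_restrict p hl ho h1 h2 hl.ne hb hc
    exact ⟨zSplitII_of_leaf_at p hp hl o a₁ a₂ b ho h1 h2 hb hx.1 hx.2.1,
      zSplitIIQ_of_leaf_at p hp hl o a₁ a₂ b ho h1 h2 hb hx.2.1,
      zSplitI_of_leaf_at p hp hl o a₁ a₂ b ho h1 h2 hb hx.2.2.1 hx.2.2.2,
      zSplitIQ_of_leaf_at p hp hl o a₁ a₂ b ho h1 h2 hb hx.2.2.2⟩

/-- **The four forms travel along every sequence of weighted moves.** -/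
theorem fourForms_of_movesW {E' : Type u} [Fintype E'] [DecidableEq E'] {ends' : E' → Sym2 V}
    {p' : E' → R} {v' : V} {E : Type u} [Fintype E] [DecidableEq E] {ends : E → Sym2 V} {p : E → R}
    {v : V} (h : MovesW o a₁ a₂ b E' ends' p' v' E ends p v) (hp : IsProbVec p)
    (hc : FourForms p' ends' o a₁ a₂ v' b) : FourForms p ends o a₁ a₂ v b := by
  induction h with
  | refl => exact hc
  | tail _ hstep ih => exact fourForms_of_moveStepW hstep hp (ih (hstep.isProbVec hp))

end MovesW

section GluedAnchors
variable {V : Type*} {E : Type*} [Fintype E] [DecidableEq E] [Fintype V] [DecidableEq V]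
  {R : Type*} [Field R] [LinearOrder R] [IsStrictOrderedRing R]
variable {ends : E → Sym2 V} {a₁ a₂ a₃ w : V} {e : E}

/-- **The glued anchor `₂`**: every edge at `a₃` goes to `a₁` or to `w`, and some edge `{a₂, w}` has
weight `1` — all four forms at `a₃` for that weight vector (CaseOneGlued). -/
theorem fourForms_of_rootsOnly_glued₂ (p : E → R) (hp : IsProbVec p) (he : p e = 1)
    (hends : ends e = s(a₂, w))
    (hroot : ∀ e', a₃ ∈ ends e' → ends e' = s(a₁, a₃) ∨ ends e' = s(w, a₃)) (h1 : a₁ ≠ a₃)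
    (o : V) {b : V} (hb : b ≠ a₃) : FourForms p ends o a₁ a₂ a₃ b :=
  ⟨zSplitII_of_rootsOnly_glued₂ p hp he hends hroot h1 o b,
    zSplitIIQ_of_rootsOnly_glued₂ p hp he hends hroot h1 o b,
    zSplitI_of_rootsOnly_glued₂ p hp he hends hroot h1 o hb,
    zSplitIQ_of_rootsOnly_glued₂ p hp he hends hroot h1 o hb⟩

/-- **The glued anchor `₁`**: every edge at `a₃` goes to `w` or to `a₂`, and some edge `{a₁, w}` has
weight `1`. -/
theorem fourForms_of_rootsOnly_glued₁ (p : E → R) (hp : IsProbVec p) (he : p e = 1)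
    (hends : ends e = s(a₁, w))
    (hroot : ∀ e', a₃ ∈ ends e' → ends e' = s(w, a₃) ∨ ends e' = s(a₂, a₃)) (hw : w ≠ a₃)
    (o : V) {b : V} (hb : b ≠ a₃) : FourForms p ends o a₁ a₂ a₃ b :=
  ⟨zSplitII_of_rootsOnly_glued₁ p hp he hends hroot hw o b,
    zSplitIIQ_of_rootsOnly_glued₁ p hp he hends hroot hw o b,
    zSplitI_of_rootsOnly_glued₁ p hp he hends hroot hw o hb,
    zSplitIQ_of_rootsOnly_glued₁ p hp he hends hroot hw o hb⟩

end GluedAnchors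

section MovesGlued
variable {V : Type*} [Fintype V] [DecidableEq V] {R : Type*} [Field R] [LinearOrder R]
  [IsStrictOrderedRing R] {o a₁ a₂ b : V}

/-- **The four forms for every weight vector reachable by weighted moves from a glued instance `₂`.** -/
theorem fourForms_of_movesW_glued₂ {E' : Type u} [Fintype E'] [DecidableEq E'] {ends' : E' → Sym2 V}
    {p' : E' → R} {a₃ w : V} {e : E'} {E : Type u} [Fintype E] [DecidableEq E] {ends : E → Sym2 V}
    {p : E → R} {v : V} (h : MovesW o a₁ a₂ b E' ends' p' a₃ E ends p v) (hp : IsProbVec p)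
    (he : p' e = 1) (hends : ends' e = s(a₂, w))
    (hroot : ∀ e', a₃ ∈ ends' e' → ends' e' = s(a₁, a₃) ∨ ends' e' = s(w, a₃)) (h1 : a₁ ≠ a₃)
    (hb : b ≠ a₃) : FourForms p ends o a₁ a₂ v b :=
  fourForms_of_movesW h hp (fourForms_of_rootsOnly_glued₂ p' (h.isProbVec hp) he hends hroot h1 o hb)

/-- **The four forms for every weight vector reachable by weighted moves from a glued instance `₁`.** -/
theorem fourForms_of_movesW_glued₁ {E' : Type u} [Fintype E'] [DecidableEq E'] {ends' : E' → Sym2 V}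
    {p' : E' → R} {a₃ w : V} {e : E'} {E : Type u} [Fintype E] [DecidableEq E] {ends : E → Sym2 V}
    {p : E → R} {v : V} (h : MovesW o a₁ a₂ b E' ends' p' a₃ E ends p v) (hp : IsProbVec p)
    (he : p' e = 1) (hends : ends' e = s(a₁, w))
    (hroot : ∀ e', a₃ ∈ ends' e' → ends' e' = s(w, a₃) ∨ ends' e' = s(a₂, a₃)) (hw : w ≠ a₃)
    (hb : b ≠ a₃) : FourForms p ends o a₁ a₂ v b :=
  fourForms_of_movesW h hp (fourForms_of_rootsOnly_glued₁ p' (h.isProbVec hp) he hends hroot hw o hb)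

end MovesGlued

end CaseOne

end Summit.Ventures.PercRepro2
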